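import Summits.BirchSwinnertonDyer.BirchSwinnertonDyer.Theorems.SignedBaseChangeAnticyclotomicEisensteinDivisibilityAdmdefSignedSupply
import Summits.BirchSwinnertonDyer.BirchSwinnertonDyer.Theorems.SignedBaseChangeAnticyclotomicEisensteinDivisibilityAdmdefSelmerWalk
import Summits.BirchSwinnertonDyer.BirchSwinnertonDyer.Theorems.AdditiveKolyvaginRoadAdmissibleRaiseFree
import Summits.BirchSwinnertonDyer.BirchSwinnertonDyer.Theorems.AdditiveKolyvaginRoadLevelSystemsBottomOfRaise
import Summits.BirchSwinnertonDyer.BirchSwinnertonDyer.Theorems.SchneiderFreeAdditiveX3PoitouTateSelmerDualityHolds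
import Literature.NumberTheory.Automorphic.BrandtGrossPoints
import Literature.NumberTheory.Automorphic.BrandtEigenLine
import HarnessLib

/-!
# Line `admdef`, cell β: W. Zhang's Selmer-killing walk WITH THE SIGNED TWO-PRIME DETOUR — an ODD ZERO VERTEX CARRYING BOTH
# Bertolini–Darmon signs, IN KERNEL (crux `AnticyclotomicEisensteinDivisibility`, stmt-BirchSwinnertonDyer-20727; LEAD seat bsd-line-sbc-p1 gen 18,
# `--supports stmt-BirchSwinnertonDyer-20727`; the detour is the ideator's crux idea «signdetour», bsd-idea-5 g23, `Lines/signdetour_sketch.lean` §3, credited)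

WHY THIS FILE.  The registered research stub (Anch±) `stub_definiteAnchorSigned` of the line of record `Cruxes/…/Lines/admdef.lean` (v9/v10) asks for Brandt
data with non-zero mod-`p` toric period only at odd zero vertices `n` (`Sel_n^+ = Sel_n^− = 0`) CARRYING BOTH (Equiv)-signs — X. Wan 2016 Thm 1.4, the only
general-level non-ordinary rank-0 input, needs a Steinberg prime of the right sign for `g_n` AND for `g_n ⊗ χ_K`.  The walk to such a vertex was so far kernel only
INSIDE the Cruxes workfile (§3–§4 of the inline «signdetour» block, conditional on the Props (Sup±) `SignedSupplyAt` and (Cheb) `LocalChebAt`).  With (Sup±) now a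
landed theorem on cell β (`…AdmdefSignedSupply.signedSupply_of_split`, this generation) and (Cheb)/rank lowering/descent landed in g17 (`…AdmdefSelmerWalk`),
THIS FILE lands the signed detour and its composition UNDER `Theorems/`, with every (Equiv)-sign statement UNFOLDED (the Cruxes-side `def`s `EquivSign`,
`HasBothSigns` are not importable): on cell β (`p ≥ 5`, `ρ̄_{E,p}` onto, `K` imaginary quadratic, `N_E` Heegner in `K`, `p` split, `c ≠ 1`) the consequent of
the line's [NV″] texts follows from (Par) «`dim Sel_∅⁺ + dim Sel_∅⁻` odd» and the SIGNED anchor (Anch±) alone — the input the kernel census of v10 needs.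

WHAT IS PROVED (kernel; no definition, no named fact, no `sorry`):
* `selQP_insert_eq_of_sign_ne` — WRONG-SIGN FREEZE: a new admissible `q` on whose local cohomology `c` acts by `sgnP s` does not move `Sel^{μ}`, `μ ≠ s`
  (AKR `loc_eq_zero_of_sign_ne_odd` + `selQP_insert_eq_of_forall_mem_torsionLocalKer`).
* `sign_of_selQP_insert_ne` — a prime that MOVES `Sel^s` has (Equiv)-sign `s` (AKR `localEquiv_of_admQ` + the freeze).
* `finrank_selQP_insert_eq_one` — RAISING at a zero vertex: `Sel_n^s = 0`, `q ∉ n` of sign `s` ⟹ `dim Sel_{n∪q}^s = 1` (AKR `selQP_raise_of_admQ_of_sign` + the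
  tree's `poitouTate_selmerStructure_duality_holds`).
* `exists_signed_detour_of_split` — THE SIGNED DETOUR on cell β: at a zero vertex `n` and for any sign `s`, admissible `q ∉ n`, `q′ ∉ n ∪ {q}`, both of sign `s`,
  with `n ∪ {q, q′}` again a zero vertex ((Sup±) kernel, raise, freeze, Čebotarev lowering `…AdmdefSelmerWalk.selQP_rankLowering_of_split`).
* `exists_oddZeroVertex_bothSigns_of_split` — from (Par): an odd zero vertex containing an admissible prime of EACH sign (descent + two detours).
* `definiteToricNV_of_anchorSigned_of_split` — **[NV″]'s consequent on cell β from (Par) + (Anch±)** (the v7 theorem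
  `…AdmdefSelmerWalk.definiteToricNV_of_anchor_of_split` with the anchor hypothesis WEAKENED to odd zero vertices carrying both signs).

HONEST FRAMING: ports of the ideator's kernel sketch (§3–§4) with the LEAD's cell-β inputs plugged; nothing about (Anch±), the BRIDGE or the crux is asserted.
BSD is not proved by this file.

References: [cite: WZhang2014, Lemma 5.3, Prop. 5.4, Lemma 7.3, Thm. 9.1, §9 (9.2)] [cite: BertoliniDarmon2005, Lemma 2.6, Thm. 3.2] [cite: CastellaEtAl2025, §7.4]
[cite: Wan2016NonOrdinaryIMC, Thm. 1.4] [cite: MilneADT2006, Ch. I, Thm. 4.10].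
-/

-- D-0017: single-problem summit, the namespace repeats the problem name by design.
set_option linter.dupNamespace false
set_option autoImplicit false

noncomputable section

open scoped Classical NumberField

namespace Summit.BirchSwinnertonDyer.BirchSwinnertonDyer.Theorems.SignedBaseChangeAcDivAdmdefSignedDetour

open WeierstrassCurve NumberField IsDedekindDomain Field Module
  Literature.NumberTheory.EllipticCurves Literature.NumberTheory.GaloisRepresentations Literature.NumberTheory.Automorphic
  Literature.NumberTheory.GaloisRepresentations.DiscreteGaloisModule Literature.NumberTheory.GaloisCohomology
  Summit.BirchSwinnertonDyer.BirchSwinnertonDyer.Theorems Summit.BirchSwinnertonDyer.BirchSwinnertonDyer.Theorems.AdditiveKoly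
  Summit.BirchSwinnertonDyer.BirchSwinnertonDyer.Theorems.SchneiderFreeAdditiveX3.PoitouTateReduction
  Summit.BirchSwinnertonDyer.Rank1Residual.X11b.Three.Koly.Method2

variable (W : WeierstrassCurve ℚ) (K : Type) [Field K] [NumberField K] (p : ℕ) [W.IsElliptic] [W.IsGloballyMinimal] [Fact p.Prime]

/-! ## §1 Generic kernel at a level: freeze, sign detection, raising (the (Equiv)-sign written out) -/

section Generic

variable {W K p} {c : K ≃ₐ[ℚ] K} [Module (ZMod p) (Vp W K p)]

omit [W.IsElliptic] in
/-- **The WRONG-SIGN eigenspace does not move** (W. Zhang (9.2)–(9.3)): if complex conjugation acts by `sgnP s` on `H¹(K_v, E[p])` for every `v` above the new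
admissible `q ∉ n`, then `Sel_{n∪q}^{μ} = Sel_n^{μ}` for `μ ≠ s` (every `μ`-eigenclass has localisation ZERO above `q` — `loc = −loc` on odd torsion —, and a
class with localisation zero is both Kummer and toric).  [cite: WZhang2014, §9 (9.2)–(9.3)] -/
theorem selQP_insert_eq_of_sign_ne (hp2 : p ≠ 2) {n : Finset (AdmQ W K p)} {q : AdmQ W K p} (hqn : q ∉ n) {s μ : Bool}
    (hs : ∀ v : HeightOneSpectrum (𝓞 K), ((q : ℕ) : 𝓞 K) ∈ v.asIdeal → ∀ z : Vp W K p,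
      (W.baseChange K).torsionLocMap (v.adicCompletion K) ((p ^ 1 : ℕ) : ℤ) (conjAct W c ((p ^ 1 : ℕ) : ℤ) z) =
        sgnP s • (W.baseChange K).torsionLocMap (v.adicCompletion K) ((p ^ 1 : ℕ) : ℤ) z)
    (hne : s ≠ μ) : SelQP W K p c (insert q n) μ = SelQP W K p c n μ := by
  -- adapted from Cruxes/…/Lines/signdetour_sketch.lean §3 (bsd-idea-5 g23)
  have hp : p.Prime := Fact.out
  have hNodd : Odd (((p ^ 1 : ℕ) : ℤ)) := by
    rw [pow_one]; exact_mod_cast hp.odd_of_ne_two hp2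
  refine selQP_insert_eq_of_forall_mem_torsionLocalKer W K p c n q hqn μ fun y hy v hv ↦ ?_
  exact AddMonoidHom.mem_ker.mpr
    (loc_eq_zero_of_sign_ne_odd (conjAct W c ((p ^ 1 : ℕ) : ℤ)) ((W.baseChange K).torsionLocMap (v.adicCompletion K) ((p ^ 1 : ℕ) : ℤ))
      (hs v hv) hy hne hNodd (zsmul_discreteH1_torsion ((p ^ 1 : ℕ) : ℤ) _))

/-- **A prime that MOVES `Sel^s` has (Equiv)-sign `s`**: if `Sel_{n∪q}^s ≠ Sel_n^s` then complex conjugation acts by `sgnP s` on `H¹(K_v, E[p])`, `v ∣ q`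
(`q` has some sign by AKR `localEquiv_of_admQ`, and the wrong one freezes `Sel^s`).  [cite: WZhang2014, §9 (9.2)] -/
theorem sign_of_selQP_insert_ne (hK2 : Module.finrank ℚ K = 2) (hc1 : c ≠ 1) (hp2 : p ≠ 2) {n : Finset (AdmQ W K p)} {q : AdmQ W K p}
    (hqn : q ∉ n) {s : Bool} (hmove : SelQP W K p c (insert q n) s ≠ SelQP W K p c n s) :
    ∀ v : HeightOneSpectrum (𝓞 K), ((q : ℕ) : 𝓞 K) ∈ v.asIdeal → ∀ z : Vp W K p,
      (W.baseChange K).torsionLocMap (v.adicCompletion K) ((p ^ 1 : ℕ) : ℤ) (conjAct W c ((p ^ 1 : ℕ) : ℤ) z) =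
        sgnP s • (W.baseChange K).torsionLocMap (v.adicCompletion K) ((p ^ 1 : ℕ) : ℤ) z := by
  obtain ⟨s', hs'⟩ := localEquiv_of_admQ W K p hK2 hc1 q
  by_cases h : s' = s
  · exact h ▸ hs'
  · exact absurd (selQP_insert_eq_of_sign_ne hp2 hqn hs' h) hmove

/-- **RAISING AT A ZERO VERTEX** (Gross–Parson parity, raising half; W. Zhang Lemma 5.3 ∕ Prop. 5.4): if `Sel_n^s = 0` and complex conjugation acts by
`sgnP s` above the new admissible `q ∉ n`, then `dim Sel_{n∪q}^s = 1` — AKR `selQP_raise_of_admQ_of_sign` (witness-free raising) with the Poitou–Tate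
fact discharged by the tree's `poitouTate_selmerStructure_duality_holds`.  [cite: WZhang2014, Lemma 5.3, Prop. 5.4] [cite: MilneADT2006, Ch. I, Thm. 4.10] -/
theorem finrank_selQP_insert_eq_one (hK : IsImaginaryQuadratic K) (hp2 : p ≠ 2) {n : Finset (AdmQ W K p)} {q : AdmQ W K p}
    (hqn : q ∉ n) {s : Bool}
    (hs : ∀ v : HeightOneSpectrum (𝓞 K), ((q : ℕ) : 𝓞 K) ∈ v.asIdeal → ∀ z : Vp W K p,
      (W.baseChange K).torsionLocMap (v.adicCompletion K) ((p ^ 1 : ℕ) : ℤ) (conjAct W c ((p ^ 1 : ℕ) : ℤ) z) =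
        sgnP s • (W.baseChange K).torsionLocMap (v.adicCompletion K) ((p ^ 1 : ℕ) : ℤ) z)
    (hzero : SelQP W K p c n s = ⊥) :
    finrank (ZMod p) (SelQP W K p c (insert q n) s) = 1 := by
  obtain ⟨v, hv⟩ := exists_heightOneSpectrum_natCast_mem' K q.2.1
  have h := selQP_raise_of_admQ_of_sign W K p hK hp2 (poitouTate_selmerStructure_duality_holds K) n q s v hqn hv (hs v hv)
    (fun y hy ↦ by rw [hzero, Submodule.mem_bot] at hy; rw [hy]; exact zero_mem _)
  rw [h, hzero, finrank_bot]

omit [W.IsElliptic] in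
/-- A space of positive dimension has a non-zero vector (bookkeeping). [folklore] -/
theorem exists_ne_zero_of_finrank_pos {n : Finset (AdmQ W K p)} {μ : Bool} (h : 0 < finrank (ZMod p) (SelQP W K p c n μ)) :
    ∃ x ∈ SelQP W K p c n μ, x ≠ 0 := by
  by_contra hall
  push Not at hall
  have : SelQP W K p c n μ = ⊥ := (Submodule.eq_bot_iff _).mpr hall
  rw [this, finrank_bot] at h
  exact lt_irrefl 0 h

end Generic

/-! ## §2 Cell β: the signed detour, an odd zero vertex carrying both signs, and [NV″]'s consequent from (Par) + (Anch±) -/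

section Beta

variable {c : K ≃ₐ[ℚ] K}

/-- **THE SIGNED DETOUR on cell β** (`p ≥ 5`, `ρ̄_{E,p}` onto, `K` imaginary quadratic, `N_E` Heegner in `K`, `p` split, `c ≠ 1`).  At a zero vertex `n`
(`Sel_n^+ = Sel_n^− = 0`) and for ANY sign `s` there are admissible `q ∉ n` and `q′ ∉ n ∪ {q}`, on BOTH of whose local cohomologies `c` acts by `sgnP s`, with
`n ∪ {q, q′}` again a zero vertex: take `q` of sign `s` outside `n` ((Sup±), `…AdmdefSignedSupply.signedSupply_of_split`); `Sel_{n∪q}^s` is a line (raising) and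
`Sel_{n∪q}^{¬s} = 0` (freeze); a Čebotarev prime `q′` detecting a generator (`…AdmdefSelmerWalk.selQP_rankLowering_of_split`) lowers `Sel^s` back to `0`, leaves
`Sel^{¬s} = 0`, and has sign `s` because it moves `Sel^s`.  Port of the ideator's `Signdetour.exists_signed_detour` with the cell-β inputs plugged.
[cite: WZhang2014, Lemma 5.3, Prop. 5.4, Lemma 7.3, §9 (9.2)] [cite: BertoliniDarmon2005, Thm. 3.2] -/
theorem exists_signed_detour_of_split (h5 : 5 ≤ p) (hsurj : W.HasSurjectiveModNGaloisRep p) (hK : IsImaginaryQuadratic K)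
    (hH : SatisfiesHeegnerHypothesis (W.conductorNorm ℤ) K) (hsp : ((Ideal.span {(p : ℤ)}).primesOver (𝓞 K)).ncard = 2)
    (hc1 : c ≠ 1) [Module (ZMod p) (Vp W K p)]
    (n : Finset (AdmQ W K p)) (hzero : ∀ μ : Bool, SelQP W K p c n μ = ⊥) (s : Bool) :
    ∃ q q' : AdmQ W K p, q ∉ n ∧ q' ∉ insert q n ∧
      (∀ v : HeightOneSpectrum (𝓞 K), ((q : ℕ) : 𝓞 K) ∈ v.asIdeal → ∀ z : Vp W K p,
        (W.baseChange K).torsionLocMap (v.adicCompletion K) ((p ^ 1 : ℕ) : ℤ) (conjAct W c ((p ^ 1 : ℕ) : ℤ) z) =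
          sgnP s • (W.baseChange K).torsionLocMap (v.adicCompletion K) ((p ^ 1 : ℕ) : ℤ) z) ∧
      (∀ v : HeightOneSpectrum (𝓞 K), ((q' : ℕ) : 𝓞 K) ∈ v.asIdeal → ∀ z : Vp W K p,
        (W.baseChange K).torsionLocMap (v.adicCompletion K) ((p ^ 1 : ℕ) : ℤ) (conjAct W c ((p ^ 1 : ℕ) : ℤ) z) =
          sgnP s • (W.baseChange K).torsionLocMap (v.adicCompletion K) ((p ^ 1 : ℕ) : ℤ) z) ∧
      ∀ μ : Bool, SelQP W K p c (insert q' (insert q n)) μ = ⊥ := by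
  -- adapted from Cruxes/…/Lines/signdetour_sketch.lean §3 `exists_signed_detour` (bsd-idea-5 g23)
  have hp2 : p ≠ 2 := by omega
  obtain ⟨q, hqn, hqs⟩ := SignedBaseChangeAcDivAdmdefSignedSupply.signedSupply_of_split W K p h5 hsurj hK hH hsp hc1 s n
  -- after `q`: the `s`-part is a line, the `¬s`-part is still zero
  have h1 : finrank (ZMod p) (SelQP W K p c (insert q n) s) = 1 := finrank_selQP_insert_eq_one hK hp2 hqn hqs (hzero s)
  have h1' : SelQP W K p c (insert q n) (!s) = ⊥ := by
    rw [selQP_insert_eq_of_sign_ne hp2 hqn hqs (by cases s <;> decide), hzero]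
  obtain ⟨d, hd, hd0⟩ := exists_ne_zero_of_finrank_pos (by rw [h1]; exact one_pos)
  -- kill the new class at a Čebotarev prime `q'`
  obtain ⟨q', hq'n, hdq', -, hfr, heq⟩ :=
    SignedBaseChangeAcDivAdmdefSelmerWalk.selQP_rankLowering_of_split W K p h5 hsurj hK hH hsp hc1 (insert q n) s d hd hd0
  refine ⟨q, q', hqn, hq'n, hqs, ?_, fun μ ↦ ?_⟩
  · refine sign_of_selQP_insert_ne hK.1 hc1 hp2 hq'n fun h ↦ hdq' ?_
    rw [h]; exact hd
  · by_cases hμ : μ = s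
    · subst hμ
      haveI := finiteDimensional_selQP W K p c (insert q' (insert q n)) μ
      have h0 : finrank (ZMod p) (SelQP W K p c (insert q' (insert q n)) μ) = 0 := by omega
      exact Submodule.finrank_eq_zero.mp h0
    · have hμ' : μ = !s := by cases μ <;> cases s <;> simp_all
      rw [hμ', heq, h1']

/-- **AN ODD ZERO VERTEX CARRYING BOTH SIGNS on cell β.**  From (Par) «`dim Sel_∅⁺ + dim Sel_∅⁻` odd»: W. Zhang's walk to an odd zero vertex `n₀`
(`…AdmdefSelmerWalk.exists_zero_vertex_above_of_split`), then one signed detour of each sign — an admissible level of odd cardinality `#n₀ + 4` with `Sel^± = 0`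
containing, for each sign `s`, a prime on whose local cohomology `c` acts by `sgnP s`.  Port of the ideator's `Signdetour.exists_oddZeroVertex_bothSigns`.
[cite: WZhang2014, Thm. 9.1 (proof)] [cite: CastellaEtAl2025, §7.4] [cite: Wan2016NonOrdinaryIMC, Thm. 1.4] -/
theorem exists_oddZeroVertex_bothSigns_of_split (h5 : 5 ≤ p) (hsurj : W.HasSurjectiveModNGaloisRep p) (hK : IsImaginaryQuadratic K)
    (hH : SatisfiesHeegnerHypothesis (W.conductorNorm ℤ) K) (hsp : ((Ideal.span {(p : ℤ)}).primesOver (𝓞 K)).ncard = 2)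
    (hc1 : c ≠ 1) [Module (ZMod p) (Vp W K p)]
    (hodd : Odd (finrank (ZMod p) (SelQP W K p c ∅ true) + finrank (ZMod p) (SelQP W K p c ∅ false))) :
    ∃ n : Finset (AdmQ W K p), Odd n.card ∧
      (∀ s : Bool, ∃ q ∈ n, ∀ v : HeightOneSpectrum (𝓞 K), ((q : ℕ) : 𝓞 K) ∈ v.asIdeal → ∀ z : Vp W K p,
        (W.baseChange K).torsionLocMap (v.adicCompletion K) ((p ^ 1 : ℕ) : ℤ) (conjAct W c ((p ^ 1 : ℕ) : ℤ) z) =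
          sgnP s • (W.baseChange K).torsionLocMap (v.adicCompletion K) ((p ^ 1 : ℕ) : ℤ) z) ∧
      (∀ μ : Bool, SelQP W K p c n μ = ⊥) ∧
      n.card = finrank (ZMod p) (SelQP W K p c ∅ true) + finrank (ZMod p) (SelQP W K p c ∅ false) + 4 := by
  -- adapted from Cruxes/…/Lines/signdetour_sketch.lean §3 `exists_oddZeroVertex_bothSigns` (bsd-idea-5 g23)
  obtain ⟨n₀, -, hz₀, hcard₀⟩ := SignedBaseChangeAcDivAdmdefSelmerWalk.exists_zero_vertex_above_of_split W K p h5 hsurj hK hH hsp hc1 ∅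
  rw [Finset.card_empty, zero_add] at hcard₀
  obtain ⟨q₁, q₁', hq₁, hq₁', hs₁, -, hz₁⟩ := exists_signed_detour_of_split W K p h5 hsurj hK hH hsp hc1 n₀ hz₀ true
  obtain ⟨q₂, q₂', hq₂, hq₂', hs₂, -, hz₂⟩ := exists_signed_detour_of_split W K p h5 hsurj hK hH hsp hc1 _ hz₁ false
  have hcard : (insert q₂' (insert q₂ (insert q₁' (insert q₁ n₀)))).card = n₀.card + 4 := by
    rw [Finset.card_insert_of_notMem hq₂', Finset.card_insert_of_notMem hq₂, Finset.card_insert_of_notMem hq₁',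
      Finset.card_insert_of_notMem hq₁]
  refine ⟨insert q₂' (insert q₂ (insert q₁' (insert q₁ n₀))), ?_, fun s ↦ ?_, hz₂, by rw [hcard, hcard₀]⟩
  · rw [hcard, hcard₀]
    exact hodd.add_even (by decide)
  · cases s
    · exact ⟨q₂, by simp, hs₂⟩
    · exact ⟨q₁, by simp, hs₁⟩

/-- **[NV″]'s consequent on cell β FROM (Par) + THE SIGNED ANCHOR (Anch±)** — the statement of
`…AdmdefSelmerWalk.definiteToricNV_of_anchor_of_split` (v7) with its anchor hypothesis WEAKENED: Brandt data `(S, ψ, I, φ)` with non-zero mod-`p` toric period are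
asked only at odd zero vertices CONTAINING A PRIME OF EACH SIGN (where [Wan16, Thm. 1.4] applies to `g_n` and to `g_n ⊗ χ_K`).  Conclusion: an odd Zhang-admissible
level `s` at `(N : ℤ) = N_E` with such data — the consequent of the line's texts `DefiniteToricNVTwoMult/LeOneMult` verbatim.  Conditional only on the two displayed
hypotheses ((Par), (Anch±)); the walk, (Cheb), (Sup±) and the detours are kernel.  [cite: CastellaEtAl2025, §7.4] [cite: WZhang2014, Thm. 9.1, Thm. 7.2]
[cite: Wan2016NonOrdinaryIMC, Thm. 1.4] [cite: Gross1987, §§3–4] -/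
theorem definiteToricNV_of_anchorSigned_of_split {N : ℕ} (hN : (N : ℤ) = W.conductorNorm ℤ) (h5 : 5 ≤ p)
    (hsurj : W.HasSurjectiveModNGaloisRep p) (hK : IsImaginaryQuadratic K)
    (hHeeg : ∀ ℓ : ℕ, ℓ.Prime → ℓ ∣ N → ((Ideal.span {(ℓ : ℤ)}).primesOver (𝓞 K)).ncard = 2)
    (hsp : ((Ideal.span {(p : ℤ)}).primesOver (𝓞 K)).ncard = 2)
    (hc1 : c ≠ 1) [Module (ZMod p) (Vp W K p)]
    (hodd : Odd (finrank (ZMod p) (SelQP W K p c ∅ true) + finrank (ZMod p) (SelQP W K p c ∅ false)))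
    (hanch : ∀ n : Finset (AdmQ W K p), Odd n.card →
      (∀ s : Bool, ∃ q ∈ n, ∀ v : HeightOneSpectrum (𝓞 K), ((q : ℕ) : 𝓞 K) ∈ v.asIdeal → ∀ z : Vp W K p,
        (W.baseChange K).torsionLocMap (v.adicCompletion K) ((p ^ 1 : ℕ) : ℤ) (conjAct W c ((p ^ 1 : ℕ) : ℤ) z) =
          sgnP s • (W.baseChange K).torsionLocMap (v.adicCompletion K) ((p ^ 1 : ℕ) : ℤ) z) →
      (∀ μ : Bool, SelQP W K p c n μ = ⊥) →
      ∃ (S : Brandt.XiSetup N (∏ q ∈ n.image Subtype.val, q)) (ψ : K →ₐ[ℚ] S.D) (I : Submodule ℤ S.D)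
        (φ : Brandt.ClassSet S.O → ZMod p),
        Brandt.IsGrossPoint S.O ψ I ∧
        (letI : Fintype (Brandt.ClassSet S.O) := Fintype.ofFinite _
         φ ∈ Brandt.eigenSpace (ZMod p) (N * ∏ q ∈ n.image Subtype.val, q) (Brandt.matrix S.O) (fun ℓ ↦ W.frobeniusTrace ℓ)) ∧
        Brandt.toricPeriod S.O ψ I φ ≠ 0) :
    ∃ s : Finset ℕ, IsZhangAdmissibleLevel N K (fun ℓ ↦ W.frobeniusTrace ℓ) p s ∧ Odd s.card ∧
      ∃ (S : Brandt.XiSetup N (∏ q ∈ s, q)) (ψ : K →ₐ[ℚ] S.D) (I : Submodule ℤ S.D)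
        (φ : Brandt.ClassSet S.O → ZMod p),
        Brandt.IsGrossPoint S.O ψ I ∧
        (letI : Fintype (Brandt.ClassSet S.O) := Fintype.ofFinite _
         φ ∈ Brandt.eigenSpace (ZMod p) (N * ∏ q ∈ s, q) (Brandt.matrix S.O) (fun ℓ ↦ W.frobeniusTrace ℓ)) ∧
        Brandt.toricPeriod S.O ψ I φ ≠ 0 := by
  have hN' : N = W.conductorNorm ℤ := by exact_mod_cast hN
  have hH : SatisfiesHeegnerHypothesis (W.conductorNorm ℤ) K := fun ℓ hℓ hℓN ↦ hHeeg ℓ hℓ (hN' ▸ hℓN)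
  obtain ⟨n, hodd', hboth, hzero, -⟩ := exists_oddZeroVertex_bothSigns_of_split W K p h5 hsurj hK hH hsp hc1 hodd
  obtain ⟨S, ψ, I, φ, hGP, heig, hper⟩ := hanch n hodd' hboth hzero
  refine ⟨n.image Subtype.val, ?_, ?_, S, ψ, I, φ, hGP, heig, hper⟩
  · rw [hN']; exact SignedBaseChangeAcDivAdmdefSelmerWalk.isZhangAdmissibleLevel_image_val W K p n
  · rw [SignedBaseChangeAcDivAdmdefSelmerWalk.card_image_val]; exact hodd'

end Beta

end Summit.BirchSwinnertonDyer.BirchSwinnertonDyer.Theorems.SignedBaseChangeAcDivAdmdefSignedDetour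

end
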